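import Summits.CriticalPhenomena.CardyFormulaZ2.Theses.CardySusyWard
import Literature.Probability.LatticeModels.DartPhase
import Literature.Barriers.CriticalPhenomena.FKParafermionicHalfCauchyRiemann

/-!
# Crux-ideate sketch (round 1, ideator 2, gen 2) — crux `CardySusyWard.WeakHolomorphy`
# (stmt-CriticalPhenomena-11292): card `reflected-loop-split-bypass`

First lemmas of the line "an R1-exact Kirchhoff / anti-Kirchhoff SPLITTING of the dart observable
closes the WEAK crux by telescoping" (bypass of Zhou 2024 §5):

* `inSum` / `outSum` / `kirchhoffDefect` / `antiKirchhoffDefect` — the two in-darts and two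
  out-darts of the oriented medial lattice at the medial vertex `p = (x, i)` (positions of the
  barrier file's `medialCornersAt`: for a horizontal edge `i = 0` the in-darts sit NE/SW, for a
  vertical edge `i = 1` they sit NW/SE — checked against `cornerSource`/`cornerTarget`).
* `BoundedAntiKirchhoffSplitting` — the TRANSFER statement C⁺ (family form, signal units): on every
  compact, eventually in `δ`, the spin-1/3 dart observable `F = bondDartObservable (Λ δ) δ (1/3)`
  splits as `F = F̃ + G` with `G` bounded, `F̃` obeying the vertex relation (chirality `+i`) exactly
  and Kirchhoff up to `ε δ^{1/3}`, and `G` anti-Kirchhoff up to `ε δ^{1/3}` (Zhou's Prop. 4.3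
  (95)–(98) give this with the absolute error `O((δ/d)²)`).
* `SplittingClosesWeakHolomorphy` — the bypass lemma `C⁺ → WeakHolomorphy` (trace identity +
  "anti-Kirchhoff flows are weakly null" + summation by parts (‡)); provable now modulo the
  bookkeeping on `medialExploration` named in `Cruxes/WeakHolomorphy/Disproof.lean` §D.
* `StaggeredDefectAntiholomorphic` — the exact linear-algebra characterisation found in this seat
  (verified over `ℚ(i)` on boxes `n ≤ 6`): an exact splitting exists iff the sublattice-staggered
  Kirchhoff defect obeys the discrete Cauchy–Riemann (Duffin) equations of an ANTIholomorphic
  function around every primal vertex and face.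
-/

noncomputable section

open MeasureTheory Filter Topology Complex
open Literature.Probability.LatticeModels Literature.Probability.RandomPlanarGeometry
open Literature.Probability.Percolation Literature.Barriers.CriticalPhenomena

namespace Summit.CriticalPhenomena.CardyFormulaZ2.Cruxes.WeakHolomorphy.IdeatorTwoG2

/-- Sum of a dart function over the two IN-darts (heads at the medial vertex `p = (x,i)`): the
corners at positions NE, SW (`medialCornersAt x i 1, 3`) for a horizontal edge, NW, SE
(`medialCornersAt x i 0, 2`) for a vertical one. -/
def inSum (G : Site 2 × Site 2 → ℂ) (p : Site 2 × Fin 2) : ℂ :=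
  if p.2 = 0 then G (medialCornersAt p.1 p.2 1) + G (medialCornersAt p.1 p.2 3)
  else G (medialCornersAt p.1 p.2 0) + G (medialCornersAt p.1 p.2 2)

/-- Sum over the two OUT-darts (tails at the medial vertex). -/
def outSum (G : Site 2 × Site 2 → ℂ) (p : Site 2 × Fin 2) : ℂ :=
  if p.2 = 0 then G (medialCornersAt p.1 p.2 0) + G (medialCornersAt p.1 p.2 2)
  else G (medialCornersAt p.1 p.2 1) + G (medialCornersAt p.1 p.2 3)

/-- Kirchhoff defect `Σ_in G − Σ_out G` at a medial vertex (the missing "dual half"). -/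
def kirchhoffDefect (G : Site 2 × Site 2 → ℂ) (p : Site 2 × Fin 2) : ℂ := inSum G p - outSum G p

/-- ANTI-Kirchhoff defect `Σ_in G + Σ_out G` (an anti-Kirchhoff flow has this equal to zero). -/
def antiKirchhoffDefect (G : Site 2 × Site 2 → ℂ) (p : Site 2 × Fin 2) : ℂ := inSum G p + outSum G p

/-- The medial-sublattice sign: `+1` on horizontal lattice edges, `−1` on vertical ones. -/
def sublatticeSign (p : Site 2 × Fin 2) : ℂ := if p.2 = 0 then 1 else -1

/-- The six discretisation-family hypotheses of the crux (verbatim, bundled). -/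
def FamilyHyps (D : DobrushinDomain) (Λ : ℝ → DiscreteDobrushin) : Prop :=
  (∀ δ, (Λ δ).Ω = D.carrier) ∧ (∀ δ, (Λ δ).δ = δ) ∧
  Tendsto (fun δ : ℝ => Metric.hausdorffEDist (Λ δ).arcA (D.arc 0)) (𝓝[>] (0:ℝ)) (𝓝 0) ∧
  Tendsto (fun δ : ℝ => Metric.hausdorffEDist (Λ δ).arcB (D.arc 1)) (𝓝[>] (0:ℝ)) (𝓝 0) ∧
  Tendsto (fun δ : ℝ => Metric.hausdorffEDist (medialPoint δ '' (Λ δ).zdABEdges) {D.pt 0, D.pt 1})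
    (𝓝[>] (0:ℝ)) (𝓝 0) ∧
  (∀ᶠ δ in 𝓝[>] (0:ℝ), (Λ δ).IsZdAdmissible)

/-- The `q = 1`, spin-`1/3` DART observable of the family at mesh `δ` as a function on corners. -/
def dartObs (Λ : ℝ → DiscreteDobrushin) (δ : ℝ) : Site 2 × Site 2 → ℂ :=
  fun c => bondDartObservable (Λ δ) δ (1 / 3) c

/-- **C⁺ (transfer statement): bounded R1-exact Kirchhoff / anti-Kirchhoff splitting, family form,
signal units.** For every Dobrushin domain, admissible family and compact `K ⊂ Ω` there is `C`
such that for every `ε > 0`, eventually in `δ`, the dart observable splits as `F = F̃ + G` with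
`‖G‖ ≤ C`, `F̃ = F − G` obeying the chirality-`(+i)` vertex relation EXACTLY and the Kirchhoff law up
to `ε δ^{1/3}`, and `G` obeying the ANTI-Kirchhoff law up to `ε δ^{1/3}`, at every medial vertex over
`K`. (Zhou, arXiv:2409.03235, Prop. 4.3 (95)–(98) assert this with the absolute error
`O((δ/d_v)²)`, vertex-indexed with consistency `O((δ/d_v)^{2−ε})` (93).) -/
def BoundedAntiKirchhoffSplitting : Prop :=
  ∀ (D : DobrushinDomain) (Λ : ℝ → DiscreteDobrushin), FamilyHyps D Λ →
    ∀ K : Set ℂ, IsCompact K → K ⊆ D.carrier →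
      ∃ C : ℝ, ∀ ε > (0:ℝ), ∀ᶠ δ in 𝓝[>] (0:ℝ), ∃ G : Site 2 × Site 2 → ℂ,
        (∀ c, ‖G c‖ ≤ C) ∧
        ∀ p : Site 2 × Fin 2, medialPoint δ (medialVertexOf p) ∈ K →
          HalfCRRelationAt I (fun c => dartObs Λ δ c - G c) p ∧
          ‖kirchhoffDefect (fun c => dartObs Λ δ c - G c) p‖ ≤ ε * δ ^ ((1:ℝ) / 3) ∧
          ‖antiKirchhoffDefect G p‖ ≤ ε * δ ^ ((1:ℝ) / 3)

/-- **First lemma (bypass).** The splitting closes the weak crux: (i) the tree's bisector vertex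
observable is `(2cos(π/12))⁻¹ (Σ_in + Σ_out) F` pathwise, so the crux pairing is the smooth midpoint
pairing of the dart flow; (ii) for ANY dart function `Σ_e G(e)ψ(m_e) = ½ Σ_z ψ(z)·antiKirchhoffDefect G z
+ O(δ² Σ|G|)` — an anti-Kirchhoff flow is weakly null; (iii) for `F̃` the exact vertex relation summed
by parts (Disproof §D (‡)) leaves `−(i/2) Σ_z s_z ∂φ(z)·kirchhoffDefect F̃ z + O(δ Σ|F̃|)`. Total
`O(δ^{5/3}(δ·δ⁻² + ε δ^{1/3} δ⁻²)) → 0`. -/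
def SplittingClosesWeakHolomorphy : Prop :=
  BoundedAntiKirchhoffSplitting →
    Summit.CriticalPhenomena.CardyFormulaZ2.Theses.CardySusyWard.WeakHolomorphy

/-- Step (ii) of the bypass as a stand-alone finite-`δ` inequality (no probability): the smooth
midpoint pairing of ANY bounded dart function supported over a compact is its anti-Kirchhoff defect
paired with the test function plus a second-order Taylor remainder. Stated for the darts whose head
lies over `K`; `M` bounds `G`, `N δ⁻²` the number of darts over `K`. -/
def AntiKirchhoffWeaklyNull : Prop :=
  ∀ (ψ : ℂ → ℂ), ContDiff ℝ (⊤ : ℕ∞) ψ → HasCompactSupport ψ →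
    ∃ Cψ : ℝ, ∀ (δ : ℝ), 0 < δ → δ ≤ 1 → ∀ (G : Site 2 × Site 2 → ℂ) (M : ℝ),
      (∀ c, ‖G c‖ ≤ M) → (∀ c, ψ (dartMidpoint δ c) ≠ 0 → IsCorner c.1 c.2) →
      ‖(∑ᶠ c : Site 2 × Site 2, G c * ψ (dartMidpoint δ c)) -
          (1 / 2) * ∑ᶠ p : Site 2 × Fin 2, ψ (medialPoint δ (medialVertexOf p)) * antiKirchhoffDefect G p‖
        ≤ Cψ * M

/-- **Structure theorem behind C⁺ (exact linear algebra, verified over `ℚ(i)` on the boxes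
`n ≤ 6` in this seat; general proof = local rank computation).** For a dart function `F` obeying the
chirality-`(+i)` vertex relation at the medial vertices of a region, an EXACT splitting `F = F̃ + G`
(`F̃`, `G` obeying the vertex relation, `F̃` Kirchhoff, `G` anti-Kirchhoff, on that region) exists
iff the sublattice-STAGGERED Kirchhoff defect `κ = s · kirchhoffDefect F` is discrete
ANTIholomorphic there: around every primal vertex `x` (W, E horizontal, S, N vertical neighbours)
`κ(E) − κ(W) = i (κ(N) − κ(S))`, and the same Duffin equation around every primal face. Informal
shadow: the continuum identity (‡) `∂̄ f = −i c ∂κ`. Stated here for the vertex stencil. -/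
def StaggeredDefectAntiholomorphicAt (F : Site 2 × Site 2 → ℂ) (x : Site 2) : Prop :=
  let κ : Site 2 × Fin 2 → ℂ := fun p => sublatticeSign p * kirchhoffDefect F p
  κ (x, 0) - κ (x - Pi.single 0 1, 0) = I * (κ (x, 1) - κ (x - Pi.single 1 1, 1))

end Summit.CriticalPhenomena.CardyFormulaZ2.Cruxes.WeakHolomorphy.IdeatorTwoG2
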